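import Literature.AlgebraicGeometry.Resolution.DefectAmbient
import Literature.AlgebraicGeometry.Resolution.ValuationConjugacyNormal
import Mathlib.LinearAlgebra.Basis.Bilinear
import Mathlib.RingTheory.PowerBasis
import HarnessLib

/-!
# Defectlessness ascends along a linearly disjoint base extension (towards Kuhlmann 2010, Lemma 5.3)

Topic: `Literature/AlgebraicGeometry/Resolution` (valued function fields). A PROVED,
henselization-free replacement for the reduction step **Lemma 5.3** of F.-V. Kuhlmann,
*Elimination of ramification I: The generalized stability theorem*, Trans. AMS 362 (2010)
5697–5727 = arXiv:1003.5678 ("To prove (R2), it suffices to prove (R3)", p. 18), whose printed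
proof passes through henselizations: for `E = K(t)^h(a₁,…,a_n)` and a small algebraically
closed `k ⊆ K` of finite rank, "(R3) together with Theorem 2.14 implies that
`(k(t)^h(a₁,…,a_n)|k(t)^h,v)` is a defectless extension", then valuation regularity of
`K(t)|k(t)` (Lemma 2.20, Lemma 2.23, Cor. 2.21) and Prop. 2.24 ("`d(L|K,v) ≥ d(L.F|F,v)`", via
"`[(L.F)^h:F^h] ≤ [L^h:K^h]`"). Here the same conclusion — defectlessness ASCENDS from `F'` to
`F` along a base extension `F' → F` which is linearly disjoint from the finite extension at
hand, has `vF/vF'` torsion free and `F'v` algebraically closed — is obtained at finite level,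
the henselization being replaced by the conjugation theorem for the extensions of a valuation
in a finite normal extension (`exists_smul_eq_of_normal`, `ValuationConjugacyNormal.lean`;
Bourbaki, *Alg. Comm.* VI §8 no. 6) and by the fundamental inequality
(`FundamentalInequality_holds`). `GeneralizedStabilityFiniteRankProofs.lean` specializes it to
`F' = k(t) ⊆ F = K(t)` to PROVE the named fact `Kuhlmann2010AlgClosedFiniteRankReduction`
(`GeneralizedStabilityFiniteRank.lean`).

## The argument

Let `(F, O)` be valued, `O' = O ∩ F'`, `E | F` finite inside a finite normal `N | F` with an
`F`-basis `b`, and let `N₀ = {x ∈ N : the b-coordinates of x lie in F'}` be a subfield (an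
`F'`-form of `N`: `N = F ⊗_{F'} N₀`) stable under `Aut(N | F)`, `E₀ ⊆ E ∩ N₀` a subfield
containing `F'` with `[E₀ : F'] = [E : F]`. Then:
* an `F'`-linearly independent family in `N₀` is `F`-linearly independent
  (`linearIndependent_of_mem_form`), so the minimal polynomial over `F'` of `x ∈ N₀` is its
  minimal polynomial over `F` (`map_minpoly_eq_minpoly`), whose roots are `Aut(N | F)`-conjugates
  of `x`; hence `N₀ | F'` is NORMAL (`normal_form`), and every `σ₀ ∈ Aut(N₀ | F')` is the
  restriction of some `σ ∈ Aut(N | F)` (`exists_algEquiv_apply_mem`, base change);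
* every extension `W₀` of `O'` to `E₀` is the trace of an extension `V` of `O` to `N`
  (`exists_comap_eq_and_comap_eq_of_form`): extend `O` and `W₀` to `N`, conjugate the traces on
  `N₀`, move by the base-changed automorphism;
* for such `V`, `e(V ∩ E / F) = (vE : vF) ≥ (vE₀ : vF') = e(W₀ / F')` because
  `vF ∩ vE₀ = vF'` when `vF/vF'` is torsion free (`inf_valueSubgroup_le_of_torsionFree`,
  `DefectAmbient.lean`), and `f(W₀ / F') = 1` when `F'v` is algebraically closed
  (`inertiaDegree_eq_one_of_isAlgClosed`);
* so if `(F', O')` is defectless in `E₀`, then `∑ e f` over the extensions of `O` to `E` is at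
  least `∑ e₀ f₀ = [E₀ : F'] = [E : F]`, and the fundamental inequality gives equality:
  `(F, O)` is defectless in `E` (`IsDefectlessIn.of_form`).

## Sources

* F.-V. Kuhlmann, loc. cit., §2.4 (Lemma 2.19, Lemma 2.20, Prop. 2.24), §5 (Lemma 5.3), pp. 8,
  18 of arXiv:1003.5678 — the statement being replaced; the proof given here is [folklore]
  (linear disjointness and conjugation: N. Bourbaki, *Algèbre commutative* VI §8 no. 6,
  Prop. 7 Cor. 1; *Algèbre* V §10 (formes d'une algèbre, extension des scalaires)).

## Rendering notes

* As in the sibling files, an extension of valued fields is `[Algebra K L]` plus a valuation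
  ring upstairs, the one downstairs being its `comap`; `e`, `f`, `IsDefectlessIn` are those of
  `ValuationDefect.lean`; the indices are compared inside one value group through
  `DefectAmbient.lean`.
* The form `N₀` is given by the predicate `hN₀ : x ∈ N₀ ↔ ∀ j, b.repr x j ∈ F'` on an
  intermediate field `N₀` (that this set is a field — structure constants and `1` with
  coordinates in `F'` — is verified by the user, `GeneralizedStabilityFiniteRankProofs.lean`).
* "`vF/vF'` torsion free" is stated on `O`: `v(c)^n = v(c')` with `c ∈ F`, `c' ∈ F'`, `n ≥ 1`
  forces `v(c) ∈ vF'`; "`F'v` algebraically closed" is `IsAlgClosed (ResidueField O')`.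
-/

noncomputable section

open IsLocalRing
open scoped Pointwise

namespace Literature.AlgebraicGeometry.Resolution

universe u

/-! ### `F'`-forms of a finite extension `N | F` given by coordinates -/

section Forms

variable {F' F N : Type u} [Field F'] [Field F] [Field N] [Algebra F' F] [Algebra F N]
  [Algebra F' N] [IsScalarTower F' F N]
variable {κ : Type*} [Fintype κ] (b : Module.Basis κ F N) (N₀ : IntermediateField F' N)
  (hN₀ : ∀ x : N, x ∈ N₀ ↔ ∀ j, b.repr x j ∈ (algebraMap F' F).range)

include hN₀

omit [IsScalarTower F' F N] [Fintype κ] in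
/-- The basis vectors lie in the form `N₀`. [folklore] -/
theorem basis_mem_form (j : κ) : b j ∈ N₀ := by
  classical
  refine (hN₀ _).mpr fun j' => ?_
  rw [b.repr_self, Finsupp.single_apply]
  split_ifs
  exacts [⟨1, map_one _⟩, ⟨0, map_zero _⟩]

omit hN₀ in
/-- An element of `N` whose coordinates come from `F'` is the corresponding `F'`-combination of
the basis. [folklore] -/
theorem eq_sum_smul_of_coords {x : N} (r : κ → F') (hr : ∀ j, algebraMap F' F (r j) = b.repr x j) :
    x = ∑ j, r j • b j := by
  conv_lhs => rw [← b.sum_repr x]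
  refine Finset.sum_congr rfl fun j _ => ?_
  rw [← hr, IsScalarTower.algebraMap_smul]

omit [Fintype κ] in
/-- **Linear disjointness**: a finite family in the form `N₀` which is linearly independent over
`F'` is linearly independent over `F` (the coordinates of an `F`-relation, expanded in an
`F'`-basis of `F`, give `F'`-relations). [folklore] -/
theorem linearIndependent_of_mem_form {ι : Type*} [Fintype ι] (z : ι → N) (hz : ∀ i, z i ∈ N₀)
    (hli : LinearIndependent F' z) : LinearIndependent F z := by
  classical
  rw [Fintype.linearIndependent_iff] at hli ⊢
  intro g hg i₀
  -- coordinates of the `z i` in `b` lie in `F'`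
  choose r hr using fun i j => (hN₀ (z i)).mp (hz i) j
  -- an `F'`-basis of `F`
  let e := Module.Basis.ofVectorSpace F' F
  -- from `∑ g i • z i = 0`: for every `j`, `∑ i, r i j • g i = 0` in `F`
  have hcoord : ∀ j, ∑ i, r i j • g i = 0 := by
    intro j
    have h := congrArg (fun x => b.repr x j) hg
    rw [map_zero, Finsupp.zero_apply, map_sum, Finsupp.finsetSum_apply] at h
    rw [← h]
    refine Finset.sum_congr rfl fun i _ => ?_
    rw [map_smul, Finsupp.smul_apply, smul_eq_mul, Algebra.smul_def, hr, mul_comm]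
  -- for every `m`, the `F'`-combination `∑ i, e.repr (g i) m • z i` vanishes
  have hcomb : ∀ m, ∑ i, (e.repr (g i) m) • z i = 0 := by
    intro m
    rw [b.ext_elem_iff]
    intro j
    have h1 : ∀ i, b.repr ((e.repr (g i) m) • z i) j = algebraMap F' F (e.repr (g i) m * r i j) := by
      intro i
      rw [← IsScalarTower.algebraMap_smul F (e.repr (g i) m) (z i), map_smul, Finsupp.smul_apply,
        smul_eq_mul, map_mul, hr]
    have h2 : (∑ i, e.repr (g i) m * r i j) = e.repr (∑ i, r i j • g i) m := by
      rw [map_sum, Finsupp.finsetSum_apply]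
      refine Finset.sum_congr rfl fun i _ => ?_
      rw [map_smul, Finsupp.smul_apply, smul_eq_mul, mul_comm]
    rw [map_zero, Finsupp.zero_apply, map_sum, Finsupp.finsetSum_apply]
    simp_rw [h1]
    rw [← map_sum, h2, hcoord j, map_zero, Finsupp.zero_apply, map_zero]
  have hzero : ∀ m i, e.repr (g i) m = 0 := fun m => hli _ (hcomb m)
  apply e.repr.injective
  rw [map_zero]
  ext m
  rw [hzero m i₀, Finsupp.coe_zero, Pi.zero_apply]

/-- The basis `b`, viewed in the form `N₀`, is an `F'`-basis of `N₀`. [folklore] -/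
theorem exists_basis_form : ∃ b₀ : Module.Basis κ F' N₀, ∀ j, (b₀ j : N) = b j := by
  refine ⟨Module.Basis.mk (v := fun j => (⟨b j, basis_mem_form b N₀ hN₀ j⟩ : N₀)) ?_ ?_, fun j => ?_⟩
  · have hli : LinearIndependent F' (fun j => (b j : N)) := b.linearIndependent.restrict_scalars' F'
    exact LinearIndependent.of_comp (N₀.val.toLinearMap.restrictScalars F') hli
  · rintro ⟨x, hx⟩ -
    choose r hr using (hN₀ x).mp hx
    have hx' : (⟨x, hx⟩ : N₀) = ∑ j, r j • ⟨b j, basis_mem_form b N₀ hN₀ j⟩ := by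
      apply Subtype.ext
      rw [IntermediateField.coe_sum]
      simp_rw [IntermediateField.coe_smul]
      exact eq_sum_smul_of_coords b r hr
    rw [hx']
    exact Submodule.sum_mem _ fun j _ => Submodule.smul_mem _ _ (Submodule.subset_span ⟨j, rfl⟩)
  · simp

/-- The form is finite-dimensional over `F'`. [folklore] -/
theorem finiteDimensional_form : FiniteDimensional F' N₀ := by
  obtain ⟨b₀, -⟩ := exists_basis_form b N₀ hN₀
  exact b₀.finiteDimensional_of_finite

/-- The form has `F'`-dimension `[N : F]`. [folklore] -/
theorem finrank_form : Module.finrank F' N₀ = Module.finrank F N := by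
  obtain ⟨b₀, -⟩ := exists_basis_form b N₀ hN₀
  rw [Module.finrank_eq_card_basis b₀, Module.finrank_eq_card_basis b]

/-- **The minimal polynomial over `F'` of an element of the form is its minimal polynomial over
`F`** (linear disjointness: the powers below the degree stay independent over `F`). [folklore] -/
theorem map_minpoly_eq_minpoly {x : N} (hx : x ∈ N₀) :
    (minpoly F' x).map (algebraMap F' F) = minpoly F x := by
  haveI := finiteDimensional_form b N₀ hN₀
  have hint' : IsIntegral F' x := by
    have h := IsIntegral.of_finite F' (⟨x, hx⟩ : N₀)
    exact h.map (IsScalarTower.toAlgHom F' N₀ N)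
  have hint : IsIntegral F x := hint'.tower_top
  refine Polynomial.eq_of_monic_of_dvd_of_natDegree_le (minpoly.monic hint)
    ((minpoly.monic hint').map _) (minpoly.dvd_map_of_isScalarTower F' F x) ?_
  rw [Polynomial.natDegree_map]
  -- the powers `x^i`, `i < deg_{F'} x`, are `F`-independent elements of `F⟮x⟯`
  have hli := linearIndependent_of_mem_form b N₀ hN₀ (fun i : Fin (minpoly F' x).natDegree =>
    x ^ (i : ℕ)) (fun i => pow_mem hx _) (linearIndependent_pow x)
  have hmem : ∀ i : Fin (minpoly F' x).natDegree, x ^ (i : ℕ) ∈ IntermediateField.adjoin F {x} :=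
    fun i => pow_mem (IntermediateField.mem_adjoin_simple_self F x) _
  have hli' : LinearIndependent F fun i : Fin (minpoly F' x).natDegree =>
      (⟨x ^ (i : ℕ), hmem i⟩ : IntermediateField.adjoin F {x}) :=
    LinearIndependent.of_comp (IntermediateField.adjoin F {x}).val.toLinearMap hli
  haveI : FiniteDimensional F (IntermediateField.adjoin F {x}) :=
    IntermediateField.adjoin.finiteDimensional hint
  have h := hli'.fintype_card_le_finrank
  rwa [Fintype.card_fin, IntermediateField.adjoin.finrank hint] at h

/-- **A form stable under `Aut(N | F)` of a finite normal extension `N | F` is normal over `F'`**: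
the minimal polynomial over `F'` of `x ∈ N₀` is its minimal polynomial over `F`, whose roots in
`N` are conjugates of `x`, hence lie in `N₀`. [folklore] -/
theorem normal_form [FiniteDimensional F N] [Normal F N]
    (hstab : ∀ σ : N ≃ₐ[F] N, ∀ x ∈ N₀, σ x ∈ N₀) : Normal F' N₀ := by
  haveI := finiteDimensional_form b N₀ hN₀
  rw [normal_iff]
  intro y
  refine ⟨IsIntegral.of_finite F' y, ?_⟩
  have hmin : minpoly F' y = minpoly F' (y : N) :=
    (minpoly.algebraMap_eq (algebraMap N₀ N).injective y).symm
  rw [hmin]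
  apply IntermediateField.splits_of_splits (L := N)
  · rw [IsScalarTower.algebraMap_eq F' F N, ← Polynomial.map_map,
      map_minpoly_eq_minpoly b N₀ hN₀ y.2]
    exact Normal.splits inferInstance (y : N)
  · intro r hr
    rw [Polynomial.mem_rootSet] at hr
    have hr' : Polynomial.aeval r (minpoly F (y : N)) = 0 := by
      rw [← map_minpoly_eq_minpoly b N₀ hN₀ y.2, Polynomial.aeval_map_algebraMap]
      exact hr.2
    have hint : IsIntegral F (y : N) := IsIntegral.of_finite F _
    have heq : minpoly F r = minpoly F (y : N) :=
      (minpoly.eq_of_irreducible_of_monic (minpoly.irreducible hint) hr' (minpoly.monic hint)).symm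
    obtain ⟨σ, hσ⟩ := (Normal.minpoly_eq_iff_mem_orbit N).mp heq
    rw [← hσ]
    exact hstab σ _ y.2

/-- **Base change of automorphisms of the form**: for `N | F` finite, an `F'`-automorphism `σ₀`
of `N₀` extends to an `F`-automorphism `σ` of `N = F ⊗_{F'} N₀` — the `F`-linear map
`b j ↦ σ₀ (b j)`, multiplicative because the products `b i b j` lie in `N₀`, bijective because
`N | F` is algebraic. [folklore] -/
theorem exists_algEquiv_apply_mem [FiniteDimensional F N] (σ₀ : N₀ ≃ₐ[F'] N₀) :
    ∃ σ : N ≃ₐ[F] N, ∀ (x : N) (hx : x ∈ N₀), σ x = σ₀ ⟨x, hx⟩ := by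
  classical
  -- the `F`-linear extension of `σ₀`
  let f : N →ₗ[F] N := b.constr F fun j => (σ₀ ⟨b j, basis_mem_form b N₀ hN₀ j⟩ : N)
  have hf : ∀ (x : N) (hx : x ∈ N₀), f x = σ₀ ⟨x, hx⟩ := by
    intro x hx
    choose r hr using (hN₀ x).mp hx
    have hx' : (⟨x, hx⟩ : N₀) = ∑ j, r j • ⟨b j, basis_mem_form b N₀ hN₀ j⟩ := by
      apply Subtype.ext
      rw [IntermediateField.coe_sum]
      simp_rw [IntermediateField.coe_smul]
      exact eq_sum_smul_of_coords b r hr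
    simp only [f]
    rw [Module.Basis.constr_apply_fintype, hx', map_sum, IntermediateField.coe_sum]
    refine Finset.sum_congr rfl fun j _ => ?_
    rw [map_smul, IntermediateField.coe_smul, Module.Basis.equivFun_apply, ← hr,
      IsScalarTower.algebraMap_smul]
  -- multiplicativity, checked on the basis
  have hmul : ∀ x y : N, f (x * y) = f x * f y := by
    have key : (LinearMap.mul F N).compr₂ f = (LinearMap.mul F N).compl₁₂ f f := by
      refine LinearMap.ext_basis b b fun i j => ?_
      simp only [LinearMap.compr₂_apply, LinearMap.compl₁₂_apply, LinearMap.mul_apply']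
      have hi := basis_mem_form b N₀ hN₀ i
      have hj := basis_mem_form b N₀ hN₀ j
      rw [hf _ (mul_mem hi hj), hf _ hi, hf _ hj]
      have hij : (⟨b i * b j, mul_mem hi hj⟩ : N₀) = ⟨b i, hi⟩ * ⟨b j, hj⟩ := rfl
      rw [hij, map_mul]
      rfl
    intro x y
    have := congrArg (fun B => B x y) key
    simpa only [LinearMap.compr₂_apply, LinearMap.compl₁₂_apply, LinearMap.mul_apply'] using this
  have hone : f 1 = 1 := by
    rw [hf 1 (one_mem N₀)]
    have : (⟨1, one_mem N₀⟩ : N₀) = 1 := rfl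
    rw [this, map_one, IntermediateField.coe_one]
  exact ⟨AlgEquiv.ofBijective (AlgHom.ofLinearMap f hone hmul)
    (Algebra.IsAlgebraic.algHom_bijective _), hf⟩

omit [Algebra F' F] [IsScalarTower F' F N] [Fintype κ] hN₀ in
/-- **Moving a valuation ring by a base-changed automorphism**: if `σ ∈ Aut(N | F)` restricts
to `σ₀ ∈ Aut(N₀ | F')` on `N₀`, then for a valuation ring `V` of `N` the trace of `σ • V` on
`N₀` is `σ₀ •` (the trace of `V`). [folklore] -/
theorem comap_smul_of_apply_mem (σ₀ : N₀ ≃ₐ[F'] N₀) (σ : N ≃ₐ[F] N)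
    (hσ : ∀ (x : N) (hx : x ∈ N₀), σ x = σ₀ ⟨x, hx⟩) (V : ValuationSubring N) :
    (σ • V).comap (algebraMap N₀ N) = σ₀ • V.comap (algebraMap N₀ N) := by
  have hσ' : ∀ (x : N) (hx : x ∈ N₀), σ.symm x = σ₀.symm ⟨x, hx⟩ := by
    intro x hx
    rw [AlgEquiv.symm_apply_eq, hσ _ (σ₀.symm ⟨x, hx⟩).2]
    simp
  ext x
  rw [ValuationSubring.mem_comap, ValuationSubring.mem_pointwise_smul_iff_inv_smul_mem,
    ValuationSubring.mem_pointwise_smul_iff_inv_smul_mem, ValuationSubring.mem_comap,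
    AlgEquiv.smul_def, AlgEquiv.smul_def, AlgEquiv.aut_inv, AlgEquiv.aut_inv,
    IntermediateField.algebraMap_apply, IntermediateField.algebraMap_apply, hσ' x x.2]

end Forms

/-! ### Defectlessness below implies defectlessness above -/

section Defect

variable {F' F N : Type u} [Field F'] [Field F] [Field N] [Algebra F' F] [Algebra F N]
  [Algebra F' N] [IsScalarTower F' F N] [FiniteDimensional F N] [Normal F N]
variable {κ : Type*} [Fintype κ] (b : Module.Basis κ F N) (N₀ : IntermediateField F' N)
  (hN₀ : ∀ x : N, x ∈ N₀ ↔ ∀ j, b.repr x j ∈ (algebraMap F' F).range)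
  (hstab : ∀ σ : N ≃ₐ[F] N, ∀ x ∈ N₀, σ x ∈ N₀)
  (E₀ : IntermediateField F' N) (hE₀N₀ : E₀ ≤ N₀) (O : ValuationSubring F)

include hN₀ hstab hE₀N₀ in
/-- **Every extension of `O ∩ F'` to `E₀ ⊆ N₀` is the trace of an extension of `O` to `N`.**
Extend `O` and the given ring `W₀` to valuation rings `V₁`, `V₂` of `N`; their traces on the
normal extension `N₀ | F'` are conjugate under some `σ₀ ∈ Aut(N₀ | F')`
(`exists_smul_eq_of_normal`); the base change `σ ∈ Aut(N | F)` of `σ₀` moves `V₁` to a ring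
with trace `O` on `F` and the trace of `V₂` on `N₀ ⊇ E₀`. [folklore] -/
theorem exists_comap_eq_and_comap_eq_of_form (W₀ : ValuationSubring E₀)
    (hW₀ : W₀.comap (algebraMap F' E₀) = O.comap (algebraMap F' F)) :
    ∃ V : ValuationSubring N, V.comap (algebraMap F N) = O ∧ V.comap (algebraMap E₀ N) = W₀ := by
  haveI := finiteDimensional_form b N₀ hN₀
  haveI := normal_form b N₀ hN₀ hstab
  -- extend `O` and `W₀` to `N`
  obtain ⟨V₁, hV₁⟩ := exists_valuationSubring_comap_eq (Ω := N) O
  obtain ⟨V₂, hV₂⟩ := exists_valuationSubring_comap_eq (Ω := N) W₀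
  -- both traces on `N₀` restrict to `O ∩ F'`
  have h₁ : (V₁.comap (algebraMap N₀ N)).comap (algebraMap F' N₀) = O.comap (algebraMap F' F) := by
    rw [ValuationSubring.comap_comap, ← IsScalarTower.algebraMap_eq F' N₀ N,
      IsScalarTower.algebraMap_eq F' F N, ← ValuationSubring.comap_comap, hV₁]
  have h₂ : (V₂.comap (algebraMap N₀ N)).comap (algebraMap F' N₀) = O.comap (algebraMap F' F) := by
    rw [ValuationSubring.comap_comap, ← IsScalarTower.algebraMap_eq F' N₀ N, ← hW₀, ← hV₂,
      ValuationSubring.comap_comap, ← IsScalarTower.algebraMap_eq F' E₀ N]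
  obtain ⟨σ₀, hσ₀⟩ := exists_smul_eq_of_normal F' (V₁.comap (algebraMap N₀ N))
    (V₂.comap (algebraMap N₀ N)) (h₁.trans h₂.symm)
  obtain ⟨σ, hσ⟩ := exists_algEquiv_apply_mem b N₀ hN₀ σ₀
  refine ⟨σ • V₁, ?_, ?_⟩
  · -- the base change fixes `F`
    rw [← hV₁]
    ext c
    rw [ValuationSubring.mem_comap, ValuationSubring.mem_comap,
      ValuationSubring.mem_pointwise_smul_iff_inv_smul_mem, AlgEquiv.smul_def, AlgEquiv.commutes]
  · -- the trace on `E₀ ⊆ N₀` is that of `V₂`, i.e. `W₀`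
    ext x
    have hxN₀ : (x : N) ∈ N₀ := hE₀N₀ x.2
    have h := congrArg (fun W => (⟨(x : N), hxN₀⟩ : N₀) ∈ W)
      (comap_smul_of_apply_mem N₀ σ₀ σ hσ V₁)
    simp only [hσ₀, ValuationSubring.mem_comap, IntermediateField.algebraMap_apply, eq_iff_iff] at h
    rw [ValuationSubring.mem_comap, IntermediateField.algebraMap_apply, h, ← hV₂,
      ValuationSubring.mem_comap, IntermediateField.algebraMap_apply]

omit [FiniteDimensional F N] [Normal F N] in
/-- **`vF ∩ vE₀ ⊆ vF'` inside the value group of `V`** when `vF/vF'` is torsion free (stated on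
`O = V ∩ F`) and `E₀ | F'` is finite: the value-group disjointness of Kuhlmann 2010, Lemma 2.19.
[folklore] -/
theorem inf_valueSubgroup_le_of_torsionFree [FiniteDimensional F' E₀] (V : ValuationSubring N)
    (hV : V.comap (algebraMap F N) = O)
    (htf : ∀ (c : F) (n : ℕ), 0 < n →
      (∃ c' : F', c' ≠ 0 ∧ O.valuation c ^ n = O.valuation (algebraMap F' F c')) →
      ∃ c'' : F', O.valuation c = O.valuation (algebraMap F' F c'')) :
    valueSubgroup F V ⊓ valueSubgroup E₀ V ≤ valueSubgroup F' V := by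
  subst hV
  refine inf_valueSubgroup_le_of_isAlgebraic V (K := F') (F := F) (N := E₀) ?_ ?_
  · intro γ hγ n hn hγn
    obtain ⟨c, hc0, hγc⟩ := (mem_valueSubgroup_iff F V γ).mp hγ
    obtain ⟨c', hc'0, hγc'⟩ := (mem_valueSubgroup_iff F' V _).mp hγn
    -- transport the relation `v(c)^n = v(c')` down to `O = V ∩ F`
    have hrel : (V.comap (algebraMap F N)).valuation c ^ n =
        (V.comap (algebraMap F N)).valuation (algebraMap F' F c') := by
      apply valueGroupHom_injective F V
      rw [map_pow, valueGroupHom_valuation, valueGroupHom_valuation, ← IsScalarTower.algebraMap_apply,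
        ← hγc', ← hγc, Units.val_pow_eq_pow_val]
    obtain ⟨c'', hc''⟩ := htf c n hn ⟨c', hc'0, hrel⟩
    have hγ'' : (γ : V.ValueGroup) = V.valuation (algebraMap F' N c'') := by
      rw [hγc, ← valueGroupHom_valuation F V c, hc'', valueGroupHom_valuation,
        ← IsScalarTower.algebraMap_apply]
    refine (mem_valueSubgroup_iff F' V γ).mpr ⟨c'', ?_, hγ''⟩
    rintro rfl
    rw [map_zero, map_zero] at hγ''
    exact γ.ne_zero hγ''
  · -- elements of `E₀` are algebraic over (the image of) `F'`
    intro x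
    set Kr : Subfield N := (algebraMap F' N).fieldRange
    letI : Algebra F' Kr := (algebraMap F' N).rangeRestrictField.toAlgebra
    haveI : IsScalarTower F' Kr N := IsScalarTower.of_algebraMap_eq fun c => rfl
    have hx : IsAlgebraic F' (algebraMap E₀ N x) :=
      (Algebra.IsAlgebraic.isAlgebraic (R := F') x).algHom (IsScalarTower.toAlgHom F' E₀ N)
    exact hx.extendScalars (algebraMap F' Kr).injective

/-- **`f = 1` below**: an extension `W₀` of `O ∩ F'` to the finite extension `E₀ | F'` has
inertia degree `1` when the residue field of `O ∩ F'` is algebraically closed. [folklore] -/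
theorem inertiaDegree_eq_one_of_isAlgClosed {F' E₀ : Type u} [Field F'] [Field E₀] [Algebra F' E₀]
    [FiniteDimensional F' E₀] (O' : ValuationSubring F') [IsAlgClosed (ResidueField O')]
    (W₀ : ValuationSubring E₀) (hW₀ : W₀.comap (algebraMap F' E₀) = O') :
    inertiaDegree F' W₀ = 1 := by
  subst hW₀
  set L₀ : Subfield (ResidueField W₀) := residueSubfield F' W₀
  -- `L₀ ≅ κ(O')` is algebraically closed
  have hL₀ : (residueFieldHom F' W₀).fieldRange = L₀ := fieldRange_residueFieldHom F' W₀
  haveI : IsAlgClosed L₀ := by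
    have e : ResidueField (W₀.comap (algebraMap F' E₀)) ≃+* L₀ :=
      (RingEquiv.ofBijective (residueFieldHom F' W₀).rangeRestrictField
        (residueFieldHom F' W₀).rangeRestrictField_bijective).trans (RingEquiv.subfieldCongr hL₀)
    exact IsAlgClosed.of_ringEquiv _ _ e
  haveI : Module.Finite L₀ (ResidueField W₀) := (ramificationIndex_mul_inertiaDegree_le_finrank F' W₀).2.1
  haveI : Algebra.IsIntegral L₀ (ResidueField W₀) := Algebra.IsIntegral.of_finite L₀ _
  have hbij := IsAlgClosed.algebraMap_bijective_of_isIntegral (k := L₀) (K := ResidueField W₀)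
  unfold inertiaDegree
  rw [← (LinearEquiv.ofBijective (Algebra.linearMap L₀ (ResidueField W₀)) hbij).finrank_eq,
    Module.finrank_self]

include hN₀ hstab hE₀N₀ in
/-- **Defectlessness ascends along a linearly disjoint, value-torsion-free base extension with
algebraically closed lower residue field.** Setting: `F' → F` valued by `O = F°` and
`O' = O ∩ F'`; `N | F` finite normal with an `F`-basis `b`; `N₀ = {x ∈ N : b-coordinates in F'}`
an `F'`-form of `N` which is a field stable under `Aut(N | F)`; `E ⊆ N` an intermediate field
over `F` and `E₀ ⊆ E ∩ N₀` an intermediate field over `F'` with `[E₀ : F'] = [E : F]`. If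
`(F', O')` is defectless in `E₀`, `vF/vF'` is torsion free and `F'v = κ(O')` is algebraically
closed, then `(F, O)` is defectless in `E`. PROOF: by the fundamental inequality it suffices to
show `∑_{O₁} e(O₁/F) f(O₁/F) ≥ [E : F]` over the extensions `O₁` of `O` to `E`. Every extension
`W₀` of `O'` to `E₀` is the trace of some extension `V` of `O` to `N`
(`exists_comap_eq_and_comap_eq_of_form`), whose trace `Φ(W₀)` on `E` is an extension of `O` with
`e(Φ(W₀)/F) = (vE : vF) ≥ (vE₀ : vF') = e(W₀/F')` (`vF ∩ vE₀ = vF'`,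
`relIndex_le_relIndex_of_inf_le`) and `f ≥ 1 = f(W₀/F')`; `Φ` is injective, so
`∑_{O₁} e f ≥ ∑_{W₀} e(W₀/F') f(W₀/F') = [E₀ : F'] = [E : F]`. (This replaces, for the
reduction step Lemma 5.3 of Kuhlmann 2010, the passage through henselizations — Thm. 2.14,
Cor. 2.21, Prop. 2.24: "`[(L.F)^h:F^h] ≤ [L^h:K^h]`" — by the conjugation theorem.) [folklore] -/
theorem IsDefectlessIn.of_form (E : IntermediateField F N) (hE₀E : (E₀ : Set N) ⊆ E)
    (hdeg : Module.finrank F' E₀ = Module.finrank F E)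
    (hdef : IsDefectlessIn F' (O.comap (algebraMap F' F)) E₀)
    (htf : ∀ (c : F) (n : ℕ), 0 < n →
      (∃ c' : F', c' ≠ 0 ∧ O.valuation c ^ n = O.valuation (algebraMap F' F c')) →
      ∃ c'' : F', O.valuation c = O.valuation (algebraMap F' F c''))
    (hres : IsAlgClosed (ResidueField (O.comap (algebraMap F' F)))) :
    IsDefectlessIn F O E := by
  classical
  haveI : FiniteDimensional F' E₀ := by
    apply Module.finite_of_finrank_pos
    rw [hdeg]
    exact Module.finrank_pos
  -- the fundamental inequality for `E | F`
  obtain ⟨s, hs, hle⟩ := FundamentalInequality_holds F E inferInstance O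
  refine ⟨s, hs, le_antisymm hle ?_⟩
  -- the extensions of `O ∩ F'` to `E₀`, each the trace of an extension `V W₀` of `O` to `N`
  obtain ⟨s₀, hs₀, hsum₀⟩ := hdef
  have hV : ∀ W₀ : ValuationSubring E₀, W₀ ∈ s₀ → ∃ V : ValuationSubring N,
      V.comap (algebraMap F N) = O ∧ V.comap (algebraMap E₀ N) = W₀ := fun W₀ hW₀ =>
    exists_comap_eq_and_comap_eq_of_form b N₀ hN₀ hstab E₀ hE₀N₀ O W₀ ((hs₀ W₀).mp hW₀)
  choose! V hVF hVE₀ using hV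
  -- `Φ W₀`: the trace on `E`, an extension of `O`
  let Φ : ValuationSubring E₀ → ValuationSubring E := fun W₀ => (V W₀).comap (algebraMap E N)
  have hΦs : ∀ W₀ ∈ s₀, Φ W₀ ∈ s := fun W₀ hW₀ => (hs _).mpr (by
    simp only [Φ]
    rw [ValuationSubring.comap_comap, ← IsScalarTower.algebraMap_eq, hVF W₀ hW₀])
  have hmemΦ : ∀ W₀ ∈ s₀, ∀ x : E₀, x ∈ W₀ ↔ (⟨(x : N), hE₀E x.2⟩ : E) ∈ Φ W₀ := by
    intro W₀ hW₀ x
    have h1 : x ∈ W₀ ↔ (x : N) ∈ V W₀ := by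
      conv_lhs => rw [← hVE₀ W₀ hW₀]
      rw [ValuationSubring.mem_comap, IntermediateField.algebraMap_apply]
    rw [h1]
    simp only [Φ]
    rw [ValuationSubring.mem_comap, IntermediateField.algebraMap_apply]
  have hΦinj : Set.InjOn Φ s₀ := by
    intro W₀ hW₀ W₀' hW₀' h
    ext x
    rw [hmemΦ W₀ hW₀, hmemΦ W₀' hW₀', h]
  -- `e(W₀/F') ≤ e(Φ W₀/F)` and `f(W₀/F') = 1 ≤ f(Φ W₀/F)`
  have hef : ∀ W₀ ∈ s₀, ramificationIndex F' W₀ * inertiaDegree F' W₀ ≤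
      ramificationIndex F (Φ W₀) * inertiaDegree F (Φ W₀) := by
    intro W₀ hW₀
    haveI := hres
    rw [inertiaDegree_eq_one_of_isAlgClosed (O.comap (algebraMap F' F)) W₀ ((hs₀ W₀).mp hW₀),
      mul_one]
    refine le_trans ?_ (Nat.le_mul_of_pos_right _
      (one_le_ramificationIndex_and_inertiaDegree F (Φ W₀)).2)
    -- both indices inside the value group of `V W₀`
    have e0 : ramificationIndex F' W₀ =
        (valueSubgroup F' (V W₀)).relIndex (valueSubgroup E₀ (V W₀)) := by
      rw [← ramificationIndex_comap_eq_relIndex, hVE₀ W₀ hW₀]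
    simp only [Φ]
    rw [e0, ramificationIndex_comap_eq_relIndex]
    refine relIndex_le_relIndex_of_inf_le ?_ ?_ ?_ ?_ ?_
    · refine valueSubgroup_le_of_range_subset _ ?_
      rintro _ ⟨c, rfl⟩
      exact ⟨algebraMap F' F c, (IsScalarTower.algebraMap_apply F' F N c).symm⟩
    · refine valueSubgroup_le_of_range_subset _ ?_
      rintro _ ⟨x, rfl⟩
      exact ⟨⟨x, hE₀E x.2⟩, rfl⟩
    · refine valueSubgroup_le_of_range_subset _ ?_
      rintro _ ⟨c, rfl⟩
      exact ⟨algebraMap F' E₀ c, (IsScalarTower.algebraMap_apply F' E₀ N c).symm⟩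
    · exact inf_valueSubgroup_le_of_torsionFree E₀ O (V W₀) (hVF W₀ hW₀) htf
    · rw [← ramificationIndex_comap_eq_relIndex]
      exact Nat.one_le_iff_ne_zero.mp (one_le_ramificationIndex_and_inertiaDegree F _).1
  -- counting
  calc Module.finrank F E = Module.finrank F' E₀ := hdeg.symm
    _ = ∑ W₀ ∈ s₀, ramificationIndex F' W₀ * inertiaDegree F' W₀ := hsum₀.symm
    _ ≤ ∑ W₀ ∈ s₀, ramificationIndex F (Φ W₀) * inertiaDegree F (Φ W₀) := Finset.sum_le_sum hef
    _ = ∑ O₁ ∈ s₀.image Φ, ramificationIndex F O₁ * inertiaDegree F O₁ :=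
        (Finset.sum_image (f := fun O₁ => ramificationIndex F O₁ * inertiaDegree F O₁) hΦinj).symm
    _ ≤ ∑ O₁ ∈ s, ramificationIndex F O₁ * inertiaDegree F O₁ :=
        Finset.sum_le_sum_of_subset_of_nonneg (fun O₁ hO₁ => by
          obtain ⟨W₀, hW₀, rfl⟩ := Finset.mem_image.mp hO₁
          exact hΦs W₀ hW₀) (fun _ _ _ => Nat.zero_le _)

end Defect

end Literature.AlgebraicGeometry.Resolution
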